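import Summits.RiemannHypothesis.RiemannHypothesis.Theorems.WeilWindowFlowGronwallLeakageIffRH
import Literature.NumberTheory.LFunctions.UniformWeilPositivityRH
import HarnessLib

/-!
# `GronwallLeakage` and its last stub `StrictPos` are Weil positivity at every window
(crux stmt-RiemannHypothesis-1037, route WeilWindowFlow; line `Sketch`, lead gen 1)

The landed calibration `gronwallLeakage_iff_riemannHypothesis` (crux `X ⟺ RH`) and
`strictPos_iff_riemannHypothesis` (the one open stub of line `Sketch` `⟺ RH`), composed with Yoshida's
criterion `riemannHypothesis_iff_forall_weilPositivityOn` and Weil's criterion `weil_criterion_holds`,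
identify both VERBATIM with the tree's standing Weil-positivity statements:

* `UniformWeilPositivity = ∀ a > 0, WeilPositivityOn a` — the body of the shared thesis item
  stmt-RiemannHypothesis-0098 (`WeilPos.WeilposThesis` / `WeilAdversary.AdversaryThesis` / `WeilComb.CombThesis`);
* `WeilPositivity` (Weil 1952).

So the crux chain of stmt-RiemannHypothesis-1037 has no content left beyond item 0098: whatever closes
0098 closes 1037 by `gronwallLeakage_iff_uniformWeilPositivity.2`, and conversely.

Axioms ⊆ {propext, Classical.choice, Quot.sound}.
-/

-- `Summit.RiemannHypothesis.RiemannHypothesis.…` repeats a namespace component by design (D-0017 layout).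
set_option linter.dupNamespace false

noncomputable section

namespace Summit.RiemannHypothesis.RiemannHypothesis.Theorems.WeilWindowFlowGronwallLeakage

open Literature.NumberTheory.LFunctions
open Summit.RiemannHypothesis.RiemannHypothesis.Theses.WeilWindowFlow

/-- **The stub is item 0098.** Strict positivity of the window bottom at every window `a > 0` is
equivalent to Weil positivity on every truncated cone, `∀ a > 0, WeilPositivityOn a`
(`UniformWeilPositivity`, the signature of item stmt-RiemannHypothesis-0098). [folklore] -/
theorem strictPos_iff_uniformWeilPositivity :
    (∀ a : ℝ, 0 < a → 0 < weilGroundEnergy a) ↔ UniformWeilPositivity :=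
  strictPos_iff_riemannHypothesis.trans riemannHypothesis_iff_forall_weilPositivityOn

/-- **The crux is item 0098.** `GronwallLeakage ⟺ ∀ a > 0, WeilPositivityOn a`. [folklore] -/
theorem gronwallLeakage_iff_uniformWeilPositivity : GronwallLeakage ↔ UniformWeilPositivity :=
  gronwallLeakage_iff_riemannHypothesis.trans riemannHypothesis_iff_forall_weilPositivityOn

/-- **The crux is Weil positivity** (Weil 1952): `GronwallLeakage ⟺ WeilPositivity`. [folklore] -/
theorem gronwallLeakage_iff_weilPositivity : GronwallLeakage ↔ WeilPositivity :=
  gronwallLeakage_iff_riemannHypothesis.trans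
    (show _root_.RiemannHypothesis ↔ WeilPositivity from weil_criterion_holds)

end Summit.RiemannHypothesis.RiemannHypothesis.Theorems.WeilWindowFlowGronwallLeakage

end
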